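import Literature.NumberTheory.LFunctions.PowerOscillatoryIntegrals
import HarnessLib

/-!
# Erdélyi's endpoint lemma for `∫₀^∞ e^{iνt} t^β h(t) dt`

Generic analytic input of the proof programme for the named fact
`Literature.Geometry.Lorentzian.Kerr.Costa2019_realAxisModeStability` (R. Teixeira da Costa,
Commun. Math. Phys. 378 (2020) 705–781 = arXiv:1910.02854 [Costa2019]): the large-`x` behaviour
of Whiting's transform `g̃(x) ∼ x^{s−1−2iMω}` (TdC Lemmas 3.14–3.15) is the endpoint asymptotics
of an oscillatory integral with amplitude `t^β h(t)`, `t = r − r₊`, `β = 2ξ − s`, `h` smooth and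
compactly supported. We prove the order-sharp two-sided version: with
`I(ν) = ∫₀^∞ e^{iνt} t^β h(t) dt`, `Re β > −1`,
* `|I(ν)| ≤ C |ν|^{−Re β − 1}` for `|ν| ≥ 1`, and
* if `h(0) ≠ 0`, `|I(ν)| ≥ c |ν|^{−Re β − 1}` for `|ν| ≥ ν₀`,
by subtracting `(h(0) + (h'(0)+h(0)) t) e^{−t}` (exact Laplace–Gamma integrals
`∫₀^∞ t^{a−1} e^{−(1−iν)t} dt = (1−iν)^{−a} Γ(a)`,
`Literature.NumberTheory.LFunctions.AFE.integral_cpow_mul_exp_neg_mul_Ioi_complex`) and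
integrating the remainder, which vanishes to second order at `t = 0`, by parts `m` times,
`Re β + 1 < m < Re β + 3`. Everything is proved.

## References
* R. Teixeira da Costa, CMP 378 (2020) 705–781, arXiv:1910.02854, Lemma 3.14, Lemma 3.15.
  [Costa2019]
* A. Erdélyi, *Asymptotic expansions*, Dover 1956, §2.8. [folklore]
-/

noncomputable section

open Complex Set MeasureTheory Filter Topology

namespace Literature.Geometry.Lorentzian.Kerr

namespace Costa2019

/-! ### Repeated integration by parts against `e^{iνt}` on `(0, ∞)` -/

/-- **One integration by parts against `e^{iνt}` on `(0, ∞)`** with vanishing boundary terms: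
if `u → 0` at `0⁺` and at `∞`, `u' ` is its derivative on `(0, ∞)` and `u, u'` are integrable
there, then `∫₀^∞ u e^{iνt} = −(1/(iν)) ∫₀^∞ u' e^{iνt}` (`ν ≠ 0`). [folklore] -/
theorem integral_Ioi_mul_cexp_I_eq_of_hasDerivAt {u u' : ℝ → ℂ} {ν : ℝ} (hν : ν ≠ 0)
    (hu : ∀ t ∈ Ioi (0 : ℝ), HasDerivAt u (u' t) t)
    (hui : IntegrableOn u (Ioi 0)) (hu'i : IntegrableOn u' (Ioi 0))
    (h0 : Tendsto u (𝓝[>] 0) (𝓝 0)) (hinf : Tendsto u atTop (𝓝 0)) :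
    ∫ t in Ioi (0 : ℝ), u t * Complex.exp (I * ν * t) =
      -(1 / (I * ν)) * ∫ t in Ioi (0 : ℝ), u' t * Complex.exp (I * ν * t) := by
  have hIν : (I * ν : ℂ) ≠ 0 := mul_ne_zero Complex.I_ne_zero (by exact_mod_cast hν)
  -- `v = e^{iνt}/(iν)`, `v' = e^{iνt}`
  set v : ℝ → ℂ := fun t => Complex.exp (I * ν * t) * (1 / (I * ν)) with hv
  set v' : ℝ → ℂ := fun t => Complex.exp (I * ν * t) with hv'
  have hvd : ∀ t, HasDerivAt v (v' t) t := by
    intro t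
    have h1 : HasDerivAt (fun t : ℝ => I * ν * (t : ℂ)) (I * ν * 1) t :=
      ((hasDerivAt_id t).ofReal_comp).const_mul (I * ν) |>.congr_deriv (by simp)
    have h2 := (h1.cexp).mul_const (1 / (I * ν))
    refine h2.congr_deriv ?_
    have hνc : (ν : ℂ) ≠ 0 := by exact_mod_cast hν
    rw [hv']
    field_simp
  have hvn : ∀ t : ℝ, ‖Complex.exp (I * ν * t)‖ = 1 := by
    intro t
    rw [show (I * ν * t : ℂ) = ((ν * t : ℝ) : ℂ) * I by push_cast; ring]
    exact Complex.norm_exp_ofReal_mul_I _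
  have hec : Continuous fun t : ℝ => Complex.exp (I * ν * t) :=
    Complex.continuous_exp.comp (continuous_const.mul Complex.continuous_ofReal)
  -- integrability of `u v'` and `u' v`
  have huv' : IntegrableOn (fun t => u t * v' t) (Ioi 0) := by
    refine (hui.norm.mono' (hui.aestronglyMeasurable.mul
      (hec.aestronglyMeasurable.restrict)) ?_)
    exact ae_of_all _ fun t => by rw [norm_mul, hvn, mul_one]
  have hu'v : IntegrableOn (fun t => u' t * v t) (Ioi 0) := by
    refine ((hu'i.norm.mul_const ‖(1 / (I * ν) : ℂ)‖).mono' (hu'i.aestronglyMeasurable.mul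
      ((hec.mul continuous_const).aestronglyMeasurable.restrict)) ?_)
    exact ae_of_all _ fun t => by rw [hv]; simp only [norm_mul, hvn, one_mul]; exact le_rfl
  -- boundary terms
  have hvb : ∀ t, ‖v t‖ ≤ ‖(1 / (I * ν) : ℂ)‖ := fun t => by
    rw [hv]; simp only [norm_mul, hvn, one_mul]; exact le_rfl
  have hlim0 : Tendsto (fun t => u t * v t) (𝓝[>] 0) (𝓝 0) := by
    refine squeeze_zero_norm' (a := fun t => ‖u t‖ * ‖(1 / (I * ν) : ℂ)‖)
      (Eventually.of_forall fun t => ?_) ?_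
    · rw [norm_mul]; exact mul_le_mul_of_nonneg_left (hvb t) (norm_nonneg _)
    · simpa using (tendsto_zero_iff_norm_tendsto_zero.1 h0).mul_const ‖(1 / (I * ν) : ℂ)‖
  have hliminf : Tendsto (fun t => u t * v t) atTop (𝓝 0) := by
    refine squeeze_zero_norm' (a := fun t => ‖u t‖ * ‖(1 / (I * ν) : ℂ)‖)
      (Eventually.of_forall fun t => ?_) ?_
    · rw [norm_mul]; exact mul_le_mul_of_nonneg_left (hvb t) (norm_nonneg _)
    · simpa using (tendsto_zero_iff_norm_tendsto_zero.1 hinf).mul_const ‖(1 / (I * ν) : ℂ)‖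
  have hibp := integral_Ioi_mul_deriv_eq_deriv_mul hu (fun t _ => hvd t) huv' hu'v hlim0 hliminf
  simp only [hv', hv, sub_zero, zero_sub] at hibp
  rw [hibp]
  rw [show (fun t => u' t * (Complex.exp (I * ν * t) * (1 / (I * ν)))) =
      fun t => (u' t * Complex.exp (I * ν * t)) * (1 / (I * ν)) by funext t; ring,
    MeasureTheory.integral_mul_const]
  ring

/-- **`m`-fold integration by parts against `e^{iνt}` on `(0, ∞)`**: for a chain
`U₀, U₁, …, U_m` with `U_{j+1} = U_j'` on `(0, ∞)`, all integrable, and `U_j → 0` at `0⁺` and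
`∞` for `j < m`: `∫₀^∞ U₀ e^{iνt} = (−1/(iν))^m ∫₀^∞ U_m e^{iνt}`. [folklore] -/
theorem integral_Ioi_mul_cexp_I_eq_iter {U : ℕ → ℝ → ℂ} {ν : ℝ} (hν : ν ≠ 0) (m : ℕ)
    (hU : ∀ j, j < m → ∀ t ∈ Ioi (0 : ℝ), HasDerivAt (U j) (U (j + 1) t) t)
    (hUi : ∀ j, j ≤ m → IntegrableOn (U j) (Ioi 0))
    (h0 : ∀ j, j < m → Tendsto (U j) (𝓝[>] 0) (𝓝 0))
    (hinf : ∀ j, j < m → Tendsto (U j) atTop (𝓝 0)) :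
    ∫ t in Ioi (0 : ℝ), U 0 t * Complex.exp (I * ν * t) =
      (-(1 / (I * ν))) ^ m * ∫ t in Ioi (0 : ℝ), U m t * Complex.exp (I * ν * t) := by
  induction m with
  | zero => simp
  | succ m ih =>
    rw [ih (fun j hj => hU j (Nat.lt_succ_of_lt hj)) (fun j hj => hUi j (Nat.le_succ_of_le hj))
      (fun j hj => h0 j (Nat.lt_succ_of_lt hj)) (fun j hj => hinf j (Nat.lt_succ_of_lt hj)),
      integral_Ioi_mul_cexp_I_eq_of_hasDerivAt hν (hU m (Nat.lt_succ_self m)) (hUi m (Nat.le_succ m))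
        (hUi (m + 1) le_rfl) (h0 m (Nat.lt_succ_self m)) (hinf m (Nat.lt_succ_self m)), pow_succ]
    ring

/-! ### Iterated derivatives of `t ↦ t^β` along the positive reals -/

/-- The falling-factorial coefficient `β(β−1)⋯(β−n+1)`. [folklore] -/
def cpowDerivCoeff (β : ℂ) : ℕ → ℂ
  | 0 => 1
  | n + 1 => cpowDerivCoeff β n * (β - n)

/-- `dⁿ/dtⁿ t^β = β(β−1)⋯(β−n+1) t^{β−n}` for `t > 0` (principal complex power of a positive
real). [folklore] -/
theorem iteratedDeriv_ofReal_cpow (β : ℂ) (n : ℕ) {t : ℝ} (ht : 0 < t) :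
    iteratedDeriv n (fun u : ℝ => (u : ℂ) ^ β) t = cpowDerivCoeff β n * (t : ℂ) ^ (β - n) := by
  induction n generalizing t with
  | zero => simp [cpowDerivCoeff]
  | succ n ih =>
    rw [iteratedDeriv_succ]
    -- near `t`, the `n`-th derivative is the explicit function
    have hloc : iteratedDeriv n (fun u : ℝ => (u : ℂ) ^ β) =ᶠ[𝓝 t]
        fun u : ℝ => cpowDerivCoeff β n * (u : ℂ) ^ (β - n) := by
      filter_upwards [Ioi_mem_nhds ht] with u hu using ih hu
    rw [hloc.deriv_eq]
    have hd := (Literature.NumberTheory.LFunctions.AFE.hasDerivAt_ofReal_cpow ht (β - n)).const_mul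
      (cpowDerivCoeff β n)
    rw [hd.deriv]
    simp only [cpowDerivCoeff]
    push_cast
    ring_nf

/-- `t ↦ t^β` is smooth at every `t > 0` (as a map `ℝ → ℂ`). [folklore] -/
theorem contDiffAt_ofReal_cpow (β : ℂ) {n : WithTop ℕ∞} {t : ℝ} (ht : 0 < t) :
    ContDiffAt ℝ n (fun u : ℝ => (u : ℂ) ^ β) t := by
  have h1 : AnalyticAt ℂ (fun z : ℂ => z ^ β) (t : ℂ) :=
    analyticAt_id.cpow analyticAt_const (Complex.ofReal_mem_slitPlane.2 ht)
  have h2 : AnalyticAt ℝ (fun u : ℝ => (u : ℂ) ^ β) t :=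
    AnalyticAt.comp (g := fun z : ℂ => z ^ β) (f := fun u : ℝ => (u : ℂ)) (x := t)
      h1.restrictScalars (Complex.ofRealCLM.analyticAt t)
  exact h2.contDiffAt

/-- **Leibniz expansion of `dʲ/dtʲ (t^β k(t))`** at `t > 0` for `k` smooth:
`Σ_{i ≤ j} C(j,i) β(β−1)⋯(β−i+1) t^{β−i} k^{(j−i)}(t)`. [folklore] -/
theorem iteratedDeriv_cpow_mul (β : ℂ) {k : ℝ → ℂ} (hk : ContDiff ℝ ((⊤ : ℕ∞) : WithTop ℕ∞) k)
    (j : ℕ) {t : ℝ} (ht : 0 < t) :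
    iteratedDeriv j (fun u : ℝ => (u : ℂ) ^ β * k u) t =
      ∑ i ∈ Finset.range (j + 1), (j.choose i : ℂ) * (cpowDerivCoeff β i * (t : ℂ) ^ (β - i)) *
        iteratedDeriv (j - i) k t := by
  have h := iteratedDeriv_mul (n := j) (f := fun u : ℝ => (u : ℂ) ^ β) (g := k) (x := t)
    (contDiffAt_ofReal_cpow β ht) (hk.of_le (by exact_mod_cast le_top)).contDiffAt
  have hfg : ((fun u : ℝ => (u : ℂ) ^ β) * k) = fun u : ℝ => (u : ℂ) ^ β * k u := rfl
  rw [hfg] at h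
  rw [h]
  refine Finset.sum_congr rfl fun i _ => ?_
  rw [iteratedDeriv_ofReal_cpow β i ht]

/-! ### The subtracted amplitude `k = h − (h(0) + (h'(0) + h(0)) t) e^{−t}` -/

/-- Iterated derivatives of `(a + bt) e^{−t}`: `(−1)ˡ (a + bt − l b) e^{−t}`. [folklore] -/
theorem iteratedDeriv_linear_mul_exp_neg (a b : ℂ) (l : ℕ) :
    iteratedDeriv l (fun t : ℝ => (a + b * t) * Complex.exp (-(t : ℂ))) =
      fun t : ℝ => (-1) ^ l * (a + b * t - l * b) * Complex.exp (-(t : ℂ)) := by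
  -- the derivative of `(a + bt)e^{−t}` is `((b − a) + (−b) t) e^{−t}`
  have hderiv : ∀ a b : ℂ, deriv (fun t : ℝ => (a + b * t) * Complex.exp (-(t : ℂ))) =
      fun t : ℝ => ((b - a) + (-b) * t) * Complex.exp (-(t : ℂ)) := by
    intro a b
    funext t
    have h0 : HasDerivAt (fun t : ℝ => (t : ℂ)) 1 t := by
      simpa using (hasDerivAt_id t).ofReal_comp
    have h1 : HasDerivAt (fun t : ℝ => a + b * (t : ℂ)) b t := by
      simpa using (h0.const_mul b).const_add a
    have h2 : HasDerivAt (fun t : ℝ => Complex.exp (-(t : ℂ))) (Complex.exp (-(t : ℂ)) * (-1)) t := by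
      simpa using h0.neg.cexp
    have h3 := h1.mul h2
    refine h3.deriv.trans ?_
    ring
  induction l generalizing a b with
  | zero => funext t; simp
  | succ l ih =>
    rw [iteratedDeriv_succ', hderiv a b, ih (b - a) (-b)]
    funext t
    push_cast
    ring

/-- `t e^{−t} ≤ 2 e^{−t/2}` for `t ≥ 0`. [folklore] -/
theorem mul_exp_neg_le (t : ℝ) (ht : 0 ≤ t) : t * Real.exp (-t) ≤ 2 * Real.exp (-t / 2) := by
  have h1 : t / 2 ≤ Real.exp (t / 2) := by
    have := Real.add_one_le_exp (t / 2)
    linarith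
  have h2 : Real.exp (-t) = Real.exp (-t / 2) * Real.exp (-t / 2) := by
    rw [← Real.exp_add]; congr 1; ring
  have h3 : Real.exp (t / 2) * Real.exp (-t / 2) = 1 := by
    rw [← Real.exp_add]; simp [show t / 2 + -t / 2 = 0 by ring]
  have hE := Real.exp_pos (-t / 2)
  nlinarith [mul_le_mul_of_nonneg_right h1 hE.le]

/-- **Bounds for the subtracted amplitude.** Let `h : ℝ → ℂ` be smooth with `h(t) = 0` for
`t ≥ T` (`T ≥ 0`), and `k(t) = h(t) − (h(0) + (h'(0) + h(0)) t) e^{−t}`. Then `k(0) = k'(0) = 0`,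
every derivative of `k` is `O(e^{−t/2})` on `[0, ∞)`, and `|k(t)| ≤ C t²`, `|k'(t)| ≤ C t` on
`[0, 1]`. [folklore] -/
theorem subtractedAmplitude_bounds {h : ℝ → ℂ} (hh : ContDiff ℝ ((⊤ : ℕ∞) : WithTop ℕ∞) h) {T : ℝ}
    (hT0 : 0 ≤ T) (hT : ∀ t, T ≤ t → h t = 0) :
    let k : ℝ → ℂ := fun t => h t - (h 0 + (deriv h 0 + h 0) * t) * Complex.exp (-(t : ℂ))
    ContDiff ℝ ((⊤ : ℕ∞) : WithTop ℕ∞) k ∧ k 0 = 0 ∧ deriv k 0 = 0 ∧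
      (∀ l : ℕ, ∃ B : ℝ, ∀ t, 0 ≤ t → ‖iteratedDeriv l k t‖ ≤ B * Real.exp (-t / 2)) ∧
      ∃ C : ℝ, ∀ t ∈ Icc (0 : ℝ) 1, ‖k t‖ ≤ C * t ^ 2 ∧ ‖deriv k t‖ ≤ C * t := by
  intro k
  set a : ℂ := h 0 with ha
  set b : ℂ := deriv h 0 + h 0 with hb
  set q : ℝ → ℂ := fun t => (a + b * t) * Complex.exp (-(t : ℂ)) with hq
  have hqs : ContDiff ℝ ((⊤ : ℕ∞) : WithTop ℕ∞) q := by
    have h0 : ContDiff ℝ ((⊤ : ℕ∞) : WithTop ℕ∞) (fun t : ℝ => (t : ℂ)) := Complex.ofRealCLM.contDiff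
    exact (contDiff_const.add (contDiff_const.mul h0)).mul (h0.neg.cexp)
  have hk_def : k = fun t => h t - q t := rfl
  have hks : ContDiff ℝ ((⊤ : ℕ∞) : WithTop ℕ∞) k := by rw [hk_def]; exact hh.sub hqs
  -- values at `0`
  have hq0 : q 0 = a := by simp [hq]
  have hk0 : k 0 = 0 := by simp [hk_def, hq0, ha]
  have htop0 : ((⊤ : ℕ∞) : WithTop ℕ∞) ≠ 0 := by simp
  have hdq : deriv q = fun t : ℝ => ((b - a) + (-b) * t) * Complex.exp (-(t : ℂ)) := by
    have h1 := iteratedDeriv_linear_mul_exp_neg a b 1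
    rw [iteratedDeriv_one] at h1
    rw [hq, h1]
    funext t
    push_cast
    ring
  have hdk : deriv k = fun t => deriv h t - deriv q t := by
    funext t
    rw [hk_def]
    exact deriv_sub ((hh.differentiable htop0) t) ((hqs.differentiable htop0) t)
  have hdk0 : deriv k 0 = 0 := by
    rw [hdk]; simp [hdq, ha, hb]
  -- iterated derivatives: locality beyond `T`, continuity on `[0, T + 1]`
  have hiter : ∀ l : ℕ, ∃ B : ℝ, ∀ t, 0 ≤ t → ‖iteratedDeriv l k t‖ ≤ B * Real.exp (-t / 2) := by
    intro l
    -- on `(T, ∞)`, `k = −q`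
    have hloc : ∀ t, T < t → iteratedDeriv l k t = -(iteratedDeriv l q t) := by
      intro t ht
      have he : k =ᶠ[𝓝 t] fun u => -q u := by
        filter_upwards [Ioi_mem_nhds ht] with u hu
        simp [hk_def, hT u (le_of_lt hu)]
      rw [(he.iteratedDeriv l).eq_of_nhds]
      have : (fun u => -q u) = fun u => (-1 : ℂ) * q u := by funext u; ring
      rw [this, iteratedDeriv_const_mul (-1 : ℂ) ((hqs.of_le (by exact_mod_cast le_top)).contDiffAt)]
      ring
    -- bound beyond `T`
    have hfar : ∀ t, T < t → 0 ≤ t → ‖iteratedDeriv l k t‖ ≤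
        (‖a‖ + ‖b‖ * 2 + l * ‖b‖) * Real.exp (-t / 2) := by
      intro t ht ht0
      rw [hloc t ht, norm_neg, hq, iteratedDeriv_linear_mul_exp_neg a b l]
      simp only [norm_mul, norm_pow, norm_neg, norm_one, one_pow, one_mul, Complex.norm_exp,
        Complex.neg_re, Complex.ofReal_re]
      have he1 : Real.exp (-t) ≤ Real.exp (-t / 2) := Real.exp_le_exp.2 (by linarith)
      have he2 := mul_exp_neg_le t ht0
      have hE := Real.exp_pos (-t / 2)
      calc ‖a + b * t - l * b‖ * Real.exp (-t) ≤ (‖a‖ + ‖b‖ * t + l * ‖b‖) * Real.exp (-t) := by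
            refine mul_le_mul_of_nonneg_right ?_ (Real.exp_pos _).le
            calc ‖a + b * t - l * b‖ ≤ ‖a + b * t‖ + ‖(l : ℂ) * b‖ := norm_sub_le _ _
              _ ≤ ‖a‖ + ‖b * (t : ℂ)‖ + ‖(l : ℂ) * b‖ := add_le_add (norm_add_le _ _) le_rfl
              _ = ‖a‖ + ‖b‖ * t + l * ‖b‖ := by
                  rw [norm_mul, norm_mul, Complex.norm_real, Complex.norm_natCast,
                    Real.norm_eq_abs, abs_of_nonneg ht0]
        _ = ‖a‖ * Real.exp (-t) + ‖b‖ * (t * Real.exp (-t)) + l * ‖b‖ * Real.exp (-t) := by ring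
        _ ≤ ‖a‖ * Real.exp (-t / 2) + ‖b‖ * (2 * Real.exp (-t / 2)) + l * ‖b‖ * Real.exp (-t / 2) := by
            gcongr
        _ = (‖a‖ + ‖b‖ * 2 + l * ‖b‖) * Real.exp (-t / 2) := by ring
    -- bound on `[0, T + 1]` by continuity
    have hcont : Continuous (iteratedDeriv l k) := hks.continuous_iteratedDeriv l (by
      exact_mod_cast le_top)
    obtain ⟨B₀, hB₀⟩ := isCompact_Icc.exists_bound_of_continuousOn
      (hcont.continuousOn (s := Icc 0 (T + 1)))
    refine ⟨max (|B₀| * Real.exp ((T + 1) / 2)) (‖a‖ + ‖b‖ * 2 + l * ‖b‖), fun t ht0 => ?_⟩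
    by_cases ht : t ≤ T + 1
    · have h1 := (hB₀ t ⟨ht0, ht⟩).trans (le_abs_self B₀)
      have h2 : |B₀| ≤ |B₀| * Real.exp ((T + 1) / 2) * Real.exp (-t / 2) := by
        rw [mul_assoc, ← Real.exp_add]
        have : 1 ≤ Real.exp ((T + 1) / 2 + -t / 2) := Real.one_le_exp (by linarith)
        nlinarith [abs_nonneg B₀]
      exact h1.trans (h2.trans (mul_le_mul_of_nonneg_right (le_max_left _ _) (Real.exp_pos _).le))
    · have ht' : T + 1 < t := not_le.1 ht
      exact (hfar t (by linarith) ht0).trans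
        (mul_le_mul_of_nonneg_right (le_max_right _ _) (Real.exp_pos _).le)
  -- Taylor bounds near `0`
  have hC2 : ∃ C, ∀ t ∈ Icc (0 : ℝ) 1, ‖k t‖ ≤ C * t ^ 2 ∧ ‖deriv k t‖ ≤ C * t := by
    have hk1 : ContDiff ℝ 1 (deriv k) := by
      have h2 : ContDiff ℝ ((1 + 1 : ℕ) : WithTop ℕ∞) k :=
        hks.of_le (WithTop.coe_le_coe.2 le_top)
      have := h2.iterate_deriv' 1 1
      simpa using this
    have hcont2 : Continuous (deriv (deriv k)) := by
      simpa using hk1.continuous_deriv le_rfl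
    obtain ⟨C₀, hC₀⟩ := isCompact_Icc.exists_bound_of_continuousOn
      (hcont2.continuousOn (s := Icc 0 1))
    have hdd : ∀ t, HasDerivAt (deriv k) (deriv (deriv k) t) t := fun t =>
      ((hk1.differentiable one_ne_zero) t).hasDerivAt
    have hd : ∀ t, HasDerivAt k (deriv k t) t := fun t => ((hks.differentiable htop0) t).hasDerivAt
    -- `|k'(t)| ≤ |C₀| t`
    have hk' : ∀ t ∈ Icc (0 : ℝ) 1, ‖deriv k t‖ ≤ |C₀| * t := by
      intro t ht
      have hmvt := norm_image_sub_le_of_norm_deriv_le_segment' (f := deriv k) (a := 0) (b := 1)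
        (fun τ _ => (hdd τ).hasDerivWithinAt)
        (fun τ hτ => (hC₀ τ (Ico_subset_Icc_self hτ)).trans (le_abs_self C₀)) t ht
      simpa [hdk0] using hmvt
    refine ⟨|C₀|, fun t ht => ⟨?_, hk' t ht⟩⟩
    -- `|k(t)| ≤ |C₀| t · t`
    have hmvt := norm_image_sub_le_of_norm_deriv_le_segment' (f := k) (a := 0) (b := t)
      (C := |C₀| * t) (fun τ _ => (hd τ).hasDerivWithinAt)
      (fun τ hτ => (hk' τ ⟨hτ.1, hτ.2.le.trans ht.2⟩).trans
        (mul_le_mul_of_nonneg_left hτ.2.le (abs_nonneg _))) t ⟨ht.1, le_rfl⟩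
    rw [hk0, sub_zero, sub_zero] at hmvt
    calc ‖k t‖ ≤ |C₀| * t * t := hmvt
      _ = |C₀| * t ^ 2 := by ring
  exact ⟨hks, hk0, hdk0, hiter, hC2⟩

/-! ### The amplitude `u = t^β k(t)` and its iterated derivatives on `(0, ∞)` -/

/-- The iterated derivatives of `u = t^β k` on the open half-line form a chain of honest
derivatives. [folklore] -/
theorem hasDerivAt_iteratedDeriv_cpow_mul (β : ℂ) {k : ℝ → ℂ}
    (hk : ContDiff ℝ ((⊤ : ℕ∞) : WithTop ℕ∞) k) (j : ℕ) {t : ℝ} (ht : 0 < t) :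
    HasDerivAt (iteratedDeriv j (fun u : ℝ => (u : ℂ) ^ β * k u))
      (iteratedDeriv (j + 1) (fun u : ℝ => (u : ℂ) ^ β * k u) t) t := by
  set u : ℝ → ℂ := fun v : ℝ => (v : ℂ) ^ β * k v with hu
  have hopen : IsOpen (Ioi (0 : ℝ)) := isOpen_Ioi
  have hus : ContDiffOn ℝ ((⊤ : ℕ∞) : WithTop ℕ∞) u (Ioi 0) := fun v hv =>
    ((contDiffAt_ofReal_cpow β hv).mul hk.contDiffAt).contDiffWithinAt
  have hdiff : DifferentiableOn ℝ (iteratedDerivWithin j u (Ioi 0)) (Ioi 0) :=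
    hus.differentiableOn_iteratedDerivWithin (WithTop.coe_lt_coe.2 (ENat.coe_lt_top j))
      hopen.uniqueDiffOn
  have heq : iteratedDerivWithin j u (Ioi 0) =ᶠ[𝓝 t] iteratedDeriv j u := by
    filter_upwards [hopen.mem_nhds ht] with v hv using iteratedDerivWithin_of_isOpen hopen hv
  have h1 : DifferentiableAt ℝ (iteratedDeriv j u) t :=
    (((hdiff t ht).differentiableAt (hopen.mem_nhds ht))).congr_of_eventuallyEq heq.symm
  rw [iteratedDeriv_succ]
  exact h1.hasDerivAt

/-- **Size of the iterated derivatives of `t^β k(t)`.** If every derivative of `k` is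
`O(e^{−t/2})` on `[0, ∞)` and `|k| ≤ C t²`, `|k'| ≤ C t` on `[0, 1]`, then for each `j` there
is `D` with `|∂ʲ(t^β k)| ≤ D t^{Re β − j + 2}` on `(0, 1]` and `|∂ʲ(t^β k)| ≤ D t^{Re β} e^{−t/2}`
on `[1, ∞)`. [folklore] -/
theorem norm_iteratedDeriv_cpow_mul_le (β : ℂ) {k : ℝ → ℂ}
    (hk : ContDiff ℝ ((⊤ : ℕ∞) : WithTop ℕ∞) k)
    (hB : ∀ l : ℕ, ∃ B : ℝ, ∀ t, 0 ≤ t → ‖iteratedDeriv l k t‖ ≤ B * Real.exp (-t / 2))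
    {C : ℝ} (hC : ∀ t ∈ Icc (0 : ℝ) 1, ‖k t‖ ≤ C * t ^ 2 ∧ ‖deriv k t‖ ≤ C * t) (j : ℕ) :
    ∃ D : ℝ, (∀ t ∈ Ioc (0 : ℝ) 1,
        ‖iteratedDeriv j (fun u : ℝ => (u : ℂ) ^ β * k u) t‖ ≤ D * t ^ (β.re - j + 2)) ∧
      ∀ t, 1 ≤ t → ‖iteratedDeriv j (fun u : ℝ => (u : ℂ) ^ β * k u) t‖ ≤
        D * (t ^ β.re * Real.exp (-t / 2)) := by
  choose Bf hBf using hB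
  -- a common constant for the finitely many derivatives of `k` involved
  set M : ℝ := |C| + ∑ l ∈ Finset.range (j + 1), |Bf l| with hM
  have hMC : |C| ≤ M := by
    have : 0 ≤ ∑ l ∈ Finset.range (j + 1), |Bf l| := Finset.sum_nonneg fun l _ => abs_nonneg _
    linarith
  have hMB : ∀ l, l ≤ j → |Bf l| ≤ M := by
    intro l hl
    have h1 : |Bf l| ≤ ∑ l ∈ Finset.range (j + 1), |Bf l| :=
      Finset.single_le_sum (fun i _ => abs_nonneg (Bf i)) (Finset.mem_range.2 (Nat.lt_succ_of_le hl))
    linarith [abs_nonneg C]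
  have hM0 : 0 ≤ M := (abs_nonneg C).trans hMC
  set D : ℝ := ∑ i ∈ Finset.range (j + 1), (j.choose i : ℝ) * ‖cpowDerivCoeff β i‖ * M with hD
  refine ⟨D, fun t ht => ?_, fun t ht => ?_⟩
  · -- `0 < t ≤ 1`
    have ht0 : 0 < t := ht.1
    rw [iteratedDeriv_cpow_mul β hk j ht0]
    refine (norm_sum_le _ _).trans ?_
    rw [hD, Finset.sum_mul]
    refine Finset.sum_le_sum fun i hi => ?_
    have hij : i ≤ j := Nat.lt_succ_iff.1 (Finset.mem_range.1 hi)
    rw [norm_mul, norm_mul, norm_mul, Complex.norm_natCast,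
      Complex.norm_cpow_eq_rpow_re_of_pos ht0, Complex.sub_re, Complex.natCast_re]
    -- the derivative of `k` of order `j - i`, with its gain near `0`
    have hkb : ‖iteratedDeriv (j - i) k t‖ * t ^ (β.re - i) ≤ M * t ^ (β.re - j + 2) := by
      have hle : ∀ {e : ℝ}, β.re - j + 2 ≤ e → t ^ e ≤ t ^ (β.re - j + 2) := fun he =>
        Real.rpow_le_rpow_of_exponent_ge ht0 ht.2 he
      rcases Nat.lt_or_ge (j - i) 2 with hlt | hge
      · interval_cases hji : j - i
        · -- `j = i`: `|k| ≤ C t²`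
          have h1 : ‖k t‖ ≤ |C| * t ^ 2 :=
            (hC t ⟨ht0.le, ht.2⟩).1.trans (mul_le_mul_of_nonneg_right (le_abs_self C) (sq_nonneg t))
          simp only [iteratedDeriv_zero]
          calc ‖k t‖ * t ^ (β.re - i) ≤ |C| * t ^ 2 * t ^ (β.re - i) :=
                mul_le_mul_of_nonneg_right h1 (Real.rpow_nonneg ht0.le _)
            _ = |C| * t ^ (β.re - i + 2) := by
                rw [Real.rpow_add ht0, Real.rpow_two]; ring
            _ ≤ M * t ^ (β.re - j + 2) := by
                refine mul_le_mul hMC (hle ?_) (Real.rpow_nonneg ht0.le _) hM0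
                have : (i : ℝ) ≤ j := by exact_mod_cast hij
                have : (j : ℝ) ≤ i := by
                  have : j ≤ i := by omega
                  exact_mod_cast this
                linarith
        · -- `j = i + 1`: `|k'| ≤ C t`
          have h1 : ‖deriv k t‖ ≤ |C| * t :=
            (hC t ⟨ht0.le, ht.2⟩).2.trans (mul_le_mul_of_nonneg_right (le_abs_self C) ht0.le)
          simp only [iteratedDeriv_one]
          calc ‖deriv k t‖ * t ^ (β.re - i) ≤ |C| * t * t ^ (β.re - i) :=
                mul_le_mul_of_nonneg_right h1 (Real.rpow_nonneg ht0.le _)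
            _ = |C| * t ^ (β.re - i + 1) := by
                rw [Real.rpow_add ht0, Real.rpow_one]; ring
            _ ≤ M * t ^ (β.re - j + 2) := by
                refine mul_le_mul hMC (hle ?_) (Real.rpow_nonneg ht0.le _) hM0
                have : (j : ℝ) = i + 1 := by
                  have : j = i + 1 := by omega
                  exact_mod_cast this
                linarith
      · -- `j - i ≥ 2`: bounded derivative
        have h1 : ‖iteratedDeriv (j - i) k t‖ ≤ M := by
          have := hBf (j - i) t ht0.le
          have hE : Real.exp (-t / 2) ≤ 1 := Real.exp_le_one_iff.2 (by linarith)
          calc ‖iteratedDeriv (j - i) k t‖ ≤ Bf (j - i) * Real.exp (-t / 2) := this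
            _ ≤ |Bf (j - i)| * 1 := by
                exact (mul_le_mul_of_nonneg_right (le_abs_self _) (Real.exp_pos _).le).trans
                  (mul_le_mul_of_nonneg_left hE (abs_nonneg _))
            _ ≤ M := by rw [mul_one]; exact hMB _ (Nat.sub_le j i)
        calc ‖iteratedDeriv (j - i) k t‖ * t ^ (β.re - i) ≤ M * t ^ (β.re - i) :=
              mul_le_mul_of_nonneg_right h1 (Real.rpow_nonneg ht0.le _)
          _ ≤ M * t ^ (β.re - j + 2) := by
              refine mul_le_mul_of_nonneg_left (hle ?_) hM0
              have : (i : ℝ) + 2 ≤ j := by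
                have : i + 2 ≤ j := by omega
                exact_mod_cast this
              linarith
    calc (j.choose i : ℝ) * (‖cpowDerivCoeff β i‖ * t ^ (β.re - i)) * ‖iteratedDeriv (j - i) k t‖ =
        (j.choose i : ℝ) * ‖cpowDerivCoeff β i‖ * (‖iteratedDeriv (j - i) k t‖ * t ^ (β.re - i)) := by
          ring
      _ ≤ (j.choose i : ℝ) * ‖cpowDerivCoeff β i‖ * (M * t ^ (β.re - j + 2)) :=
          mul_le_mul_of_nonneg_left hkb (by positivity)
      _ = (j.choose i : ℝ) * ‖cpowDerivCoeff β i‖ * M * t ^ (β.re - j + 2) := by ring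
  · -- `t ≥ 1`
    have ht0 : 0 < t := by linarith
    rw [iteratedDeriv_cpow_mul β hk j ht0]
    refine (norm_sum_le _ _).trans ?_
    rw [hD, Finset.sum_mul]
    refine Finset.sum_le_sum fun i hi => ?_
    have hij : i ≤ j := Nat.lt_succ_iff.1 (Finset.mem_range.1 hi)
    rw [norm_mul, norm_mul, norm_mul, Complex.norm_natCast,
      Complex.norm_cpow_eq_rpow_re_of_pos ht0, Complex.sub_re, Complex.natCast_re]
    have h1 : ‖iteratedDeriv (j - i) k t‖ ≤ M * Real.exp (-t / 2) :=
      (hBf (j - i) t ht0.le).trans (mul_le_mul_of_nonneg_right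
        ((le_abs_self _).trans (hMB _ (Nat.sub_le j i))) (Real.exp_pos _).le)
    have h2 : t ^ (β.re - i) ≤ t ^ β.re :=
      Real.rpow_le_rpow_of_exponent_le ht (by linarith [(Nat.cast_nonneg i : (0 : ℝ) ≤ i)])
    calc (j.choose i : ℝ) * (‖cpowDerivCoeff β i‖ * t ^ (β.re - i)) * ‖iteratedDeriv (j - i) k t‖ ≤
        (j.choose i : ℝ) * (‖cpowDerivCoeff β i‖ * t ^ β.re) * (M * Real.exp (-t / 2)) := by
          refine mul_le_mul (mul_le_mul_of_nonneg_left (mul_le_mul_of_nonneg_left h2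
            (norm_nonneg _)) (by positivity)) h1 (norm_nonneg _) (by positivity)
      _ = (j.choose i : ℝ) * ‖cpowDerivCoeff β i‖ * M * (t ^ β.re * Real.exp (-t / 2)) := by ring

/-- **Integrability and boundary behaviour of the chain `∂ʲ(t^β k)`** (`Re β > −1`): each
member is continuous on `(0, ∞)` and tends to `0` at `∞`; it is integrable on `(0, ∞)` when
`j ≤ Re β + 2` and tends to `0` at `0⁺` when `j ≤ Re β + 1`. [folklore] -/
theorem iteratedDeriv_cpow_mul_props {β : ℂ} (hβ : -1 < β.re) {k : ℝ → ℂ}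
    (hk : ContDiff ℝ ((⊤ : ℕ∞) : WithTop ℕ∞) k)
    (hB : ∀ l : ℕ, ∃ B : ℝ, ∀ t, 0 ≤ t → ‖iteratedDeriv l k t‖ ≤ B * Real.exp (-t / 2))
    {C : ℝ} (hC : ∀ t ∈ Icc (0 : ℝ) 1, ‖k t‖ ≤ C * t ^ 2 ∧ ‖deriv k t‖ ≤ C * t) (j : ℕ) :
    ContinuousOn (iteratedDeriv j (fun u : ℝ => (u : ℂ) ^ β * k u)) (Ioi 0) ∧
      ((j : ℝ) ≤ β.re + 2 → IntegrableOn (iteratedDeriv j (fun u : ℝ => (u : ℂ) ^ β * k u)) (Ioi 0)) ∧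
      ((j : ℝ) ≤ β.re + 1 →
        Tendsto (iteratedDeriv j (fun u : ℝ => (u : ℂ) ^ β * k u)) (𝓝[>] 0) (𝓝 0)) ∧
      Tendsto (iteratedDeriv j (fun u : ℝ => (u : ℂ) ^ β * k u)) atTop (𝓝 0) := by
  set U : ℝ → ℂ := iteratedDeriv j (fun u : ℝ => (u : ℂ) ^ β * k u) with hU
  obtain ⟨D, hD1, hD2⟩ := norm_iteratedDeriv_cpow_mul_le β hk hB hC j
  have hcont : ContinuousOn U (Ioi 0) := fun t ht =>
    (hasDerivAt_iteratedDeriv_cpow_mul β hk j ht).continuousAt.continuousWithinAt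
  have hD0 : 0 ≤ D := by
    have h := hD2 1 le_rfl
    have hpos : 0 < (1 : ℝ) ^ β.re * Real.exp (-1 / 2) := by positivity
    exact le_of_mul_le_mul_right (by simpa using (norm_nonneg _).trans h) hpos
  refine ⟨hcont, fun hj => ?_, fun hj => ?_, ?_⟩
  · -- integrability: split at `t = 1`
    rw [← Ioc_union_Ioi_eq_Ioi zero_le_one, integrableOn_union]
    constructor
    · have ha : -1 < β.re - j + 2 := by linarith
      have hi : IntegrableOn (fun t : ℝ => D * t ^ (β.re - j + 2)) (Ioc 0 1) := by
        have := ((intervalIntegral.intervalIntegrable_rpow' ha (a := 0) (b := 1)).const_mul D)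
        exact (intervalIntegrable_iff_integrableOn_Ioc_of_le zero_le_one).1 this
      refine hi.mono' ((hcont.mono Ioc_subset_Ioi_self).aestronglyMeasurable measurableSet_Ioc) ?_
      exact ae_restrict_of_forall_mem measurableSet_Ioc hD1
    · have h1 : IntegrableOn (fun t : ℝ => D * (Real.exp (-(1 / 2 * t)) * t ^ β.re)) (Ioi 0) :=
        (Literature.NumberTheory.LFunctions.AFE.integrableOn_exp_neg_mul_mul_rpow
          (c := 1 / 2) one_half_pos hβ).const_mul D
      have hi : IntegrableOn (fun t : ℝ => D * (Real.exp (-(1 / 2 * t)) * t ^ β.re)) (Ioi 1) :=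
        h1.mono_set (Ioi_subset_Ioi zero_le_one)
      refine hi.mono' ((hcont.mono (Ioi_subset_Ioi zero_le_one)).aestronglyMeasurable
        measurableSet_Ioi) ?_
      refine ae_restrict_of_forall_mem measurableSet_Ioi fun t ht => (hD2 t (le_of_lt ht)).trans
        (le_of_eq ?_)
      rw [mul_comm (t ^ β.re) (Real.exp (-t / 2)), show (-t / 2 : ℝ) = -(1 / 2 * t) by ring]
  · -- limit at `0⁺`
    have ha : 0 < β.re - j + 2 := by linarith
    have hlim : Tendsto (fun t : ℝ => D * t ^ (β.re - j + 2)) (𝓝[>] 0) (𝓝 0) := by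
      have h1 : Tendsto (fun t : ℝ => t ^ (β.re - j + 2)) (𝓝 0) (𝓝 0) := by
        have := (Real.continuousAt_rpow_const 0 (β.re - j + 2) (Or.inr ha.le)).tendsto
        rwa [Real.zero_rpow ha.ne'] at this
      simpa using (h1.const_mul D).mono_left nhdsWithin_le_nhds
    refine squeeze_zero_norm' ?_ hlim
    exact eventually_of_mem (Ioc_mem_nhdsGT one_pos) hD1
  · -- limit at `∞`
    have hlim : Tendsto (fun t : ℝ => D * (t ^ β.re * Real.exp (-t / 2))) atTop (𝓝 0) := by
      have h1 := tendsto_rpow_mul_exp_neg_mul_atTop_nhds_zero β.re (1 / 2) one_half_pos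
      have h2 : (fun t : ℝ => t ^ β.re * Real.exp (-(1 / 2) * t)) =
          fun t => t ^ β.re * Real.exp (-t / 2) := by
        funext t; congr 1; congr 1; ring
      rw [h2] at h1
      simpa using h1.const_mul D
    refine squeeze_zero_norm' ?_ hlim
    exact eventually_atTop.2 ⟨1, hD2⟩

/-! ### Erdélyi's lemma: decomposition, upper and lower bounds -/

/-- `e^{iνt} e^{−t} = e^{−(1 − iν)t}`. [folklore] -/
theorem cexp_I_mul_mul_cexp_neg (ν t : ℝ) :
    Complex.exp (I * ν * t) * Complex.exp (-(t : ℂ)) = Complex.exp (-((1 - I * ν) * t)) := by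
  rw [← Complex.exp_add]; congr 1; ring

/-- **Erdélyi's endpoint decomposition.** For `Re β > −1` and `h` smooth with `h = 0` on
`[T, ∞)` (`T ≥ 0`) there are `m ∈ ℕ` with `Re β + 1 < m` and `C_K` such that for all `ν ≠ 0`
`∫₀^∞ e^{iνt} t^β h(t) dt = h(0) Γ(β+1) (1−iν)^{−β−1} + (h'(0)+h(0)) Γ(β+2) (1−iν)^{−β−2} + K(ν)`
with `|K(ν)| ≤ C_K |ν|^{−m}` (the powers are principal powers of `1/(1 − iν)`).
[cite: Costa2019, Lemma 3.14 (proof), Lemma 3.15] -/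
theorem erdelyi_endpoint_decomposition {β : ℂ} (hβ : -1 < β.re) {h : ℝ → ℂ}
    (hh : ContDiff ℝ ((⊤ : ℕ∞) : WithTop ℕ∞) h) {T : ℝ} (hT0 : 0 ≤ T)
    (hT : ∀ t, T ≤ t → h t = 0) :
    ∃ (m : ℕ) (CK : ℝ), β.re + 1 < m ∧ ∀ ν : ℝ, ν ≠ 0 →
      ‖(∫ t in Ioi (0 : ℝ), Complex.exp (I * ν * t) * (t : ℂ) ^ β * h t) -
          (h 0 * ((1 / (1 - I * ν)) ^ (β + 1) * Complex.Gamma (β + 1)) +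
            (deriv h 0 + h 0) * ((1 / (1 - I * ν)) ^ (β + 2) * Complex.Gamma (β + 2)))‖ ≤
        CK * |ν| ^ (-(m : ℝ)) := by
  obtain ⟨hks, hk0, hdk0, hiter, C, hC⟩ := subtractedAmplitude_bounds hh hT0 hT
  set k : ℝ → ℂ := fun t => h t - (h 0 + (deriv h 0 + h 0) * t) * Complex.exp (-(t : ℂ)) with hk
  set a : ℂ := h 0 with ha
  set b : ℂ := deriv h 0 + h 0 with hb
  -- the number of integrations by parts
  set m : ℕ := ⌊β.re + 2⌋₊ with hm
  have hm2 : (m : ℝ) ≤ β.re + 2 := Nat.floor_le (by linarith)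
  have hm1 : β.re + 1 < m := by
    have := Nat.lt_floor_add_one (β.re + 2)
    linarith
  -- the chain `U j = ∂ʲ(t^β k)`
  set U : ℕ → ℝ → ℂ := fun j => iteratedDeriv j (fun u : ℝ => (u : ℂ) ^ β * k u) with hU
  have hprops := fun j => iteratedDeriv_cpow_mul_props hβ hks hiter hC j
  have hUd : ∀ j, j < m → ∀ t ∈ Ioi (0 : ℝ), HasDerivAt (U j) (U (j + 1) t) t :=
    fun j _ t ht => hasDerivAt_iteratedDeriv_cpow_mul β hks j ht
  have hUi : ∀ j, j ≤ m → IntegrableOn (U j) (Ioi 0) := fun j hj =>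
    (hprops j).2.1 (by
      have : (j : ℝ) ≤ m := by exact_mod_cast hj
      linarith)
  have hU0 : ∀ j, j < m → Tendsto (U j) (𝓝[>] 0) (𝓝 0) := fun j hj =>
    (hprops j).2.2.1 (by
      have : (j : ℝ) + 1 ≤ m := by exact_mod_cast hj
      linarith)
  have hUinf : ∀ j, j < m → Tendsto (U j) atTop (𝓝 0) := fun j _ => (hprops j).2.2.2
  set CK : ℝ := ∫ t in Ioi (0 : ℝ), ‖U m t‖ with hCK
  refine ⟨m, CK, hm1, fun ν hν => ?_⟩
  have hIν : (I * ν : ℂ) ≠ 0 := mul_ne_zero Complex.I_ne_zero (by exact_mod_cast hν)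
  -- the descent
  have hdesc := integral_Ioi_mul_cexp_I_eq_iter hν m hUd hUi hU0 hUinf
  -- the two exact Laplace–Gamma integrals
  have hr : 0 < (1 - I * ν : ℂ).re := by simp
  have hG1 := Literature.NumberTheory.LFunctions.AFE.integral_cpow_mul_exp_neg_mul_Ioi_complex
    (a := β + 1) (by simp; linarith) hr
  have hG2 := Literature.NumberTheory.LFunctions.AFE.integral_cpow_mul_exp_neg_mul_Ioi_complex
    (a := β + 2) (by simp; linarith) hr
  simp only [add_sub_cancel_right] at hG1
  rw [show β + 2 - 1 = β + 1 by ring] at hG2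
  -- integrability of the three pieces
  have hexpc : Continuous fun t : ℝ => Complex.exp (-((1 - I * ν) * t)) :=
    Complex.continuous_exp.comp ((continuous_const.mul continuous_ofReal).neg)
  have hcpowc : ∀ γ : ℂ, ContinuousOn (fun t : ℝ => (t : ℂ) ^ γ) (Ioi 0) := fun γ t ht =>
    (contDiffAt_ofReal_cpow γ (n := 0) ht).continuousAt.continuousWithinAt
  have hpiece : ∀ γ : ℂ, -1 < γ.re →
      IntegrableOn (fun t : ℝ => (t : ℂ) ^ γ * Complex.exp (-((1 - I * ν) * t))) (Ioi 0) := by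
    intro γ hγ
    have h1 := Literature.NumberTheory.LFunctions.AFE.integrableOn_exp_neg_mul_mul_rpow
      (c := 1) one_pos hγ
    refine h1.mono' (((hcpowc γ).mul hexpc.continuousOn).aestronglyMeasurable measurableSet_Ioi) ?_
    refine ae_restrict_of_forall_mem measurableSet_Ioi fun t ht => ?_
    have ht' : 0 < t := ht
    rw [norm_mul, Complex.norm_cpow_eq_rpow_re_of_pos ht', Complex.norm_exp]
    simp only [Complex.neg_re, Complex.mul_re, Complex.sub_re, Complex.one_re, Complex.sub_im,
      Complex.one_im, Complex.mul_im, Complex.I_re, Complex.I_im, Complex.ofReal_re,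
      Complex.ofReal_im, zero_mul, one_mul, mul_zero, sub_zero, zero_sub, zero_add]
    rw [mul_comm]
  have hI1 := hpiece β hβ
  have hI2 := hpiece (β + 1) (by simp; linarith)
  have hI0 : IntegrableOn (fun t : ℝ => U 0 t * Complex.exp (I * ν * t)) (Ioi 0) := by
    have hU0i := hUi 0 (Nat.zero_le m)
    refine (hU0i.norm.mono' (hU0i.aestronglyMeasurable.mul ((Complex.continuous_exp.comp
      (continuous_const.mul continuous_ofReal)).aestronglyMeasurable.restrict)) ?_)
    refine ae_of_all _ fun t => ?_
    rw [norm_mul, show (I * ν * t : ℂ) = ((ν * t : ℝ) : ℂ) * I by push_cast; ring,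
      Complex.norm_exp_ofReal_mul_I, mul_one]
  -- pointwise decomposition of the integrand on `(0, ∞)`
  have hpt : ∀ t ∈ Ioi (0 : ℝ), Complex.exp (I * ν * t) * (t : ℂ) ^ β * h t =
      U 0 t * Complex.exp (I * ν * t) +
        (a * ((t : ℂ) ^ β * Complex.exp (-((1 - I * ν) * t))) +
          b * ((t : ℂ) ^ (β + 1) * Complex.exp (-((1 - I * ν) * t)))) := by
    intro t ht
    have ht' : (t : ℂ) ≠ 0 := by exact_mod_cast (ne_of_gt (mem_Ioi.1 ht))
    have hh_eq : h t = k t + (a + b * t) * Complex.exp (-(t : ℂ)) := by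
      simp only [hk, ha, hb]; ring
    simp only [hU, iteratedDeriv_zero]
    rw [hh_eq, Complex.cpow_add _ _ ht', Complex.cpow_one, ← cexp_I_mul_mul_cexp_neg ν t]
    ring
  have hsplit : ∫ t in Ioi (0 : ℝ), Complex.exp (I * ν * t) * (t : ℂ) ^ β * h t =
      (∫ t in Ioi (0 : ℝ), U 0 t * Complex.exp (I * ν * t)) +
        (a * ((1 / (1 - I * ν)) ^ (β + 1) * Complex.Gamma (β + 1)) +
          b * ((1 / (1 - I * ν)) ^ (β + 2) * Complex.Gamma (β + 2))) := by
    have hI12 : Integrable (fun t : ℝ => a * ((t : ℂ) ^ β * Complex.exp (-((1 - I * ν) * t))) +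
        b * ((t : ℂ) ^ (β + 1) * Complex.exp (-((1 - I * ν) * t)))) (volume.restrict (Ioi 0)) :=
      (hI1.const_mul a).add (hI2.const_mul b)
    rw [setIntegral_congr_fun measurableSet_Ioi hpt, integral_add hI0 hI12,
      integral_add (hI1.const_mul a) (hI2.const_mul b), integral_const_mul, integral_const_mul,
      hG1, hG2]
  rw [hsplit, hdesc]
  have hrem : (-(1 / (I * ↑ν))) ^ m * (∫ t in Ioi (0 : ℝ), U m t * Complex.exp (I * ν * t)) +
      (a * ((1 / (1 - I * ν)) ^ (β + 1) * Complex.Gamma (β + 1)) +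
        b * ((1 / (1 - I * ν)) ^ (β + 2) * Complex.Gamma (β + 2))) -
      (a * ((1 / (1 - I * ν)) ^ (β + 1) * Complex.Gamma (β + 1)) +
        b * ((1 / (1 - I * ν)) ^ (β + 2) * Complex.Gamma (β + 2))) =
      (-(1 / (I * ↑ν))) ^ m * ∫ t in Ioi (0 : ℝ), U m t * Complex.exp (I * ν * t) := by ring
  rw [hrem, norm_mul, norm_pow, norm_neg, norm_div, norm_one, norm_mul, Complex.norm_I, one_mul,
    Complex.norm_real, Real.norm_eq_abs]
  have hint : ‖∫ t in Ioi (0 : ℝ), U m t * Complex.exp (I * ν * t)‖ ≤ CK := by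
    refine (norm_integral_le_integral_norm _).trans (le_of_eq ?_)
    rw [hCK]
    refine integral_congr_ae (ae_of_all _ fun t => ?_)
    show ‖U m t * Complex.exp (I * ν * t)‖ = ‖U m t‖
    rw [norm_mul, show (I * ν * t : ℂ) = ((ν * t : ℝ) : ℂ) * I by push_cast; ring,
      Complex.norm_exp_ofReal_mul_I, mul_one]
  have hνpos : 0 < |ν| := abs_pos.2 hν
  calc (1 / |ν|) ^ m * ‖∫ t in Ioi (0 : ℝ), U m t * Complex.exp (I * ν * t)‖ ≤ (1 / |ν|) ^ m * CK :=
        mul_le_mul_of_nonneg_left hint (by positivity)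
    _ = CK * |ν| ^ (-(m : ℝ)) := by
        rw [Real.rpow_neg hνpos.le, Real.rpow_natCast, one_div, inv_pow]; ring

/-! ### The size of `(1/(1 − iν))^w` -/

/-- The base `z = 1/(1 − iν)`: nonzero, `|z| = (1 + ν²)^{−1/2}`, `|arg z| ≤ π/2`. [folklore] -/
theorem one_div_one_sub_I_mul_facts (ν : ℝ) :
    (1 / (1 - I * ν) : ℂ) ≠ 0 ∧ ‖(1 / (1 - I * ν) : ℂ)‖ = (Real.sqrt (1 + ν ^ 2))⁻¹ ∧
      |Complex.arg (1 / (1 - I * ν))| ≤ Real.pi / 2 := by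
  have hd : (1 - I * ν : ℂ) ≠ 0 := by
    intro h; have := congrArg Complex.re h; simp at this
  have hz : (1 / (1 - I * ν) : ℂ) ≠ 0 := one_div_ne_zero hd
  have hnorm : ‖(1 - I * ν : ℂ)‖ = Real.sqrt (1 + ν ^ 2) := by
    rw [Complex.norm_eq_sqrt_sq_add_sq]
    congr 1
    simp
  refine ⟨hz, by rw [norm_div, norm_one, hnorm, one_div], ?_⟩
  refine Complex.abs_arg_le_pi_div_two_iff.2 ?_
  rw [one_div, Complex.inv_re]
  refine div_nonneg (by simp) (Complex.normSq_nonneg _)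

/-- **Upper bound**: `‖(1/(1−iν))^w‖ ≤ e^{π|Im w|/2} |ν|^{−Re w}` for `ν ≠ 0`, `Re w ≥ 0`.
[folklore] -/
theorem norm_one_div_one_sub_I_mul_cpow_le {ν : ℝ} (hν : ν ≠ 0) {w : ℂ} (hw : 0 ≤ w.re) :
    ‖(1 / (1 - I * ν) : ℂ) ^ w‖ ≤ Real.exp (Real.pi / 2 * |w.im|) * |ν| ^ (-w.re) := by
  obtain ⟨hz, hn, harg⟩ := one_div_one_sub_I_mul_facts ν
  have hνpos : 0 < |ν| := abs_pos.2 hν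
  have hExp : (Real.exp (Complex.arg (1 / (1 - I * ν)) * w.im))⁻¹ ≤
      Real.exp (Real.pi / 2 * |w.im|) := by
    rw [← Real.exp_neg]
    refine Real.exp_le_exp.2 ?_
    have h1 : |Complex.arg (1 / (1 - I * ν)) * w.im| ≤ Real.pi / 2 * |w.im| := by
      rw [abs_mul]; exact mul_le_mul_of_nonneg_right harg (abs_nonneg _)
    linarith [neg_abs_le (Complex.arg (1 / (1 - I * ν)) * w.im)]
  have hS : (Real.sqrt (1 + ν ^ 2))⁻¹ ^ w.re ≤ |ν| ^ (-w.re) := by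
    have h1 : (Real.sqrt (1 + ν ^ 2))⁻¹ ≤ |ν|⁻¹ := by
      refine inv_anti₀ hνpos ?_
      rw [← Real.sqrt_sq_eq_abs]
      exact Real.sqrt_le_sqrt (by nlinarith)
    calc (Real.sqrt (1 + ν ^ 2))⁻¹ ^ w.re ≤ |ν|⁻¹ ^ w.re :=
          Real.rpow_le_rpow (inv_nonneg.2 (Real.sqrt_nonneg _)) h1 hw
      _ = |ν| ^ (-w.re) := by rw [Real.rpow_neg hνpos.le, Real.inv_rpow hνpos.le]
  rw [Complex.norm_cpow_of_ne_zero hz, hn, div_eq_mul_inv, mul_comm (Real.exp (Real.pi / 2 * |w.im|))]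
  exact mul_le_mul hS hExp (inv_nonneg.2 (Real.exp_pos _).le) (Real.rpow_nonneg hνpos.le _)

/-- **Lower bound**: `‖(1/(1−iν))^w‖ ≥ e^{−π|Im w|/2} (√2)^{−Re w} |ν|^{−Re w}` for `|ν| ≥ 1`,
`Re w ≥ 0`. [folklore] -/
theorem le_norm_one_div_one_sub_I_mul_cpow {ν : ℝ} (hν : 1 ≤ |ν|) {w : ℂ} (hw : 0 ≤ w.re) :
    Real.exp (-(Real.pi / 2 * |w.im|)) * ((Real.sqrt 2) ^ (-w.re) * |ν| ^ (-w.re)) ≤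
      ‖(1 / (1 - I * ν) : ℂ) ^ w‖ := by
  obtain ⟨hz, hn, harg⟩ := one_div_one_sub_I_mul_facts ν
  have hνpos : 0 < |ν| := lt_of_lt_of_le one_pos hν
  have hs2 : 0 < Real.sqrt 2 := Real.sqrt_pos.2 two_pos
  have hS : Real.sqrt 2 ^ (-w.re) * |ν| ^ (-w.re) ≤ (Real.sqrt (1 + ν ^ 2))⁻¹ ^ w.re := by
    have hν2 : 1 ≤ ν ^ 2 := (one_le_sq_iff_one_le_abs ν).2 hν
    have h1 : (Real.sqrt 2 * |ν|)⁻¹ ≤ (Real.sqrt (1 + ν ^ 2))⁻¹ := by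
      refine inv_anti₀ (Real.sqrt_pos.2 (by positivity)) ?_
      rw [← Real.sqrt_sq_eq_abs, ← Real.sqrt_mul zero_le_two]
      exact Real.sqrt_le_sqrt (by nlinarith)
    calc Real.sqrt 2 ^ (-w.re) * |ν| ^ (-w.re) = (Real.sqrt 2 * |ν|)⁻¹ ^ w.re := by
          rw [Real.rpow_neg hs2.le, Real.rpow_neg hνpos.le, mul_inv, Real.mul_rpow
            (inv_nonneg.2 hs2.le) (inv_nonneg.2 hνpos.le), Real.inv_rpow hs2.le,
            Real.inv_rpow hνpos.le]
      _ ≤ (Real.sqrt (1 + ν ^ 2))⁻¹ ^ w.re := Real.rpow_le_rpow (by positivity) h1 hw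
  have hE1 : Real.exp (-(Real.pi / 2 * |w.im|)) * Real.exp (Complex.arg (1 / (1 - I * ν)) * w.im) ≤ 1 := by
    rw [← Real.exp_add, Real.exp_le_one_iff]
    have h1 : |Complex.arg (1 / (1 - I * ν)) * w.im| ≤ Real.pi / 2 * |w.im| := by
      rw [abs_mul]; exact mul_le_mul_of_nonneg_right harg (abs_nonneg _)
    linarith [le_abs_self (Complex.arg (1 / (1 - I * ν)) * w.im)]
  rw [Complex.norm_cpow_of_ne_zero hz, hn, le_div_iff₀ (Real.exp_pos _)]
  have hR : 0 ≤ (Real.sqrt (1 + ν ^ 2))⁻¹ ^ w.re :=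
    Real.rpow_nonneg (inv_nonneg.2 (Real.sqrt_nonneg _)) _
  calc Real.exp (-(Real.pi / 2 * |w.im|)) * (Real.sqrt 2 ^ (-w.re) * |ν| ^ (-w.re)) *
      Real.exp (Complex.arg (1 / (1 - I * ν)) * w.im) =
      (Real.exp (-(Real.pi / 2 * |w.im|)) * Real.exp (Complex.arg (1 / (1 - I * ν)) * w.im)) *
        (Real.sqrt 2 ^ (-w.re) * |ν| ^ (-w.re)) := by ring
    _ ≤ 1 * (Real.sqrt (1 + ν ^ 2))⁻¹ ^ w.re := mul_le_mul hE1 hS (by positivity) zero_le_one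
    _ = _ := one_mul _

/-- **Erdélyi's lemma, upper bound** (the order used in TdC Lemma 3.15:
`|g̃(x)| ≲ x^{−Re β − 1} = x^{s−1}`): for `Re β > −1` and `h` smooth vanishing on `[T, ∞)`,
`‖∫₀^∞ e^{iνt} t^β h(t) dt‖ ≤ C |ν|^{−Re β − 1}` for `|ν| ≥ 1`. [cite: Costa2019, Lemma 3.15] -/
theorem erdelyi_upper_bound {β : ℂ} (hβ : -1 < β.re) {h : ℝ → ℂ}
    (hh : ContDiff ℝ ((⊤ : ℕ∞) : WithTop ℕ∞) h) {T : ℝ} (hT0 : 0 ≤ T)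
    (hT : ∀ t, T ≤ t → h t = 0) :
    ∃ C : ℝ, ∀ ν : ℝ, 1 ≤ |ν| →
      ‖∫ t in Ioi (0 : ℝ), Complex.exp (I * ν * t) * (t : ℂ) ^ β * h t‖ ≤ C * |ν| ^ (-β.re - 1) := by
  obtain ⟨m, CK, hm, hK⟩ := erdelyi_endpoint_decomposition hβ hh hT0 hT
  set A₁ : ℝ := ‖h 0‖ * (Real.exp (Real.pi / 2 * |(β + 1).im|) * ‖Complex.Gamma (β + 1)‖) with hA₁
  set A₂ : ℝ := ‖deriv h 0 + h 0‖ * (Real.exp (Real.pi / 2 * |(β + 2).im|) * ‖Complex.Gamma (β + 2)‖)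
    with hA₂
  refine ⟨A₁ + A₂ + |CK|, fun ν hν => ?_⟩
  have hνpos : 0 < |ν| := lt_of_lt_of_le one_pos hν
  have hν0 : ν ≠ 0 := abs_pos.1 hνpos
  have hmain := hK ν hν0
  -- the three sizes
  have h1 : ‖h 0 * ((1 / (1 - I * ν)) ^ (β + 1) * Complex.Gamma (β + 1))‖ ≤ A₁ * |ν| ^ (-β.re - 1) := by
    rw [norm_mul, norm_mul, hA₁]
    have := norm_one_div_one_sub_I_mul_cpow_le hν0 (w := β + 1) (by simp; linarith)
    simp only [Complex.add_re, Complex.one_re] at this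
    rw [show -β.re - 1 = -(β.re + 1) by ring]
    calc ‖h 0‖ * (‖(1 / (1 - I * ↑ν)) ^ (β + 1)‖ * ‖Complex.Gamma (β + 1)‖) ≤
        ‖h 0‖ * (Real.exp (Real.pi / 2 * |(β + 1).im|) * |ν| ^ (-(β.re + 1)) * ‖Complex.Gamma (β + 1)‖) := by
          gcongr
      _ = _ := by ring
  have h2 : ‖(deriv h 0 + h 0) * ((1 / (1 - I * ν)) ^ (β + 2) * Complex.Gamma (β + 2))‖ ≤
      A₂ * |ν| ^ (-β.re - 1) := by
    rw [norm_mul, norm_mul, hA₂]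
    have := norm_one_div_one_sub_I_mul_cpow_le hν0 (w := β + 2) (by simp; linarith)
    simp only [Complex.add_re] at this
    have hle : |ν| ^ (-(β.re + (2 : ℂ).re)) ≤ |ν| ^ (-β.re - 1) :=
      Real.rpow_le_rpow_of_exponent_le hν (by simp; linarith)
    calc ‖deriv h 0 + h 0‖ * (‖(1 / (1 - I * ↑ν)) ^ (β + 2)‖ * ‖Complex.Gamma (β + 2)‖) ≤
        ‖deriv h 0 + h 0‖ * (Real.exp (Real.pi / 2 * |(β + 2).im|) * |ν| ^ (-β.re - 1) *
          ‖Complex.Gamma (β + 2)‖) := by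
          gcongr
          exact this.trans (mul_le_mul_of_nonneg_left hle (Real.exp_pos _).le)
      _ = _ := by ring
  have h3 : CK * |ν| ^ (-(m : ℝ)) ≤ |CK| * |ν| ^ (-β.re - 1) :=
    mul_le_mul (le_abs_self CK) (Real.rpow_le_rpow_of_exponent_le hν (by linarith))
      (Real.rpow_nonneg hνpos.le _) (abs_nonneg CK)
  -- assemble
  calc ‖∫ t in Ioi (0 : ℝ), Complex.exp (I * ν * t) * (t : ℂ) ^ β * h t‖ ≤
      ‖h 0 * ((1 / (1 - I * ν)) ^ (β + 1) * Complex.Gamma (β + 1)) +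
        (deriv h 0 + h 0) * ((1 / (1 - I * ν)) ^ (β + 2) * Complex.Gamma (β + 2))‖ +
        ‖(∫ t in Ioi (0 : ℝ), Complex.exp (I * ν * t) * (t : ℂ) ^ β * h t) -
          (h 0 * ((1 / (1 - I * ν)) ^ (β + 1) * Complex.Gamma (β + 1)) +
            (deriv h 0 + h 0) * ((1 / (1 - I * ν)) ^ (β + 2) * Complex.Gamma (β + 2)))‖ :=
        norm_le_insert' _ _
    _ ≤ (A₁ * |ν| ^ (-β.re - 1) + A₂ * |ν| ^ (-β.re - 1)) + |CK| * |ν| ^ (-β.re - 1) :=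
        add_le_add ((norm_add_le _ _).trans (add_le_add h1 h2)) (hmain.trans h3)
    _ = (A₁ + A₂ + |CK|) * |ν| ^ (-β.re - 1) := by ring

/-- **Erdélyi's lemma, lower bound** (the non-vanishing leading coefficient of TdC Lemma 3.14,
`Γ(2ξ − s + 1) b₀ ≠ 0` when `b₀ ≠ 0`): if moreover `h(0) ≠ 0`, then
`‖∫₀^∞ e^{iνt} t^β h(t) dt‖ ≥ c |ν|^{−Re β − 1}` for `|ν| ≥ ν₀`, with `c > 0`.
[cite: Costa2019, Lemma 3.14] -/
theorem erdelyi_lower_bound {β : ℂ} (hβ : -1 < β.re) {h : ℝ → ℂ}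
    (hh : ContDiff ℝ ((⊤ : ℕ∞) : WithTop ℕ∞) h) {T : ℝ} (hT0 : 0 ≤ T)
    (hT : ∀ t, T ≤ t → h t = 0) (h0 : h 0 ≠ 0) :
    ∃ c ν₀ : ℝ, 0 < c ∧ ∀ ν : ℝ, ν₀ ≤ |ν| →
      c * |ν| ^ (-β.re - 1) ≤ ‖∫ t in Ioi (0 : ℝ), Complex.exp (I * ν * t) * (t : ℂ) ^ β * h t‖ := by
  obtain ⟨m, CK, hm, hK⟩ := erdelyi_endpoint_decomposition hβ hh hT0 hT
  -- the leading coefficient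
  have hΓ : Complex.Gamma (β + 1) ≠ 0 := Complex.Gamma_ne_zero_of_re_pos (by simp; linarith)
  set A : ℝ := ‖h 0‖ * (Real.exp (-(Real.pi / 2 * |(β + 1).im|)) *
    ((Real.sqrt 2) ^ (-(β + 1).re)) * ‖Complex.Gamma (β + 1)‖) with hA
  have hA0 : 0 < A := by
    have h1 : 0 < ‖h 0‖ := norm_pos_iff.2 h0
    have h2 : 0 < ‖Complex.Gamma (β + 1)‖ := norm_pos_iff.2 hΓ
    have h3 : 0 < (Real.sqrt 2) ^ (-(β + 1).re) := Real.rpow_pos_of_pos (Real.sqrt_pos.2 two_pos) _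
    positivity
  set A₂ : ℝ := ‖deriv h 0 + h 0‖ * (Real.exp (Real.pi / 2 * |(β + 2).im|) * ‖Complex.Gamma (β + 2)‖)
    with hA₂
  have hA₂0 : 0 ≤ A₂ := by positivity
  -- the threshold
  set δ : ℝ := (m : ℝ) - β.re - 1 with hδ
  have hδ0 : 0 < δ := by rw [hδ]; linarith
  set ν₁ : ℝ := (4 * |CK| / A + 1) ^ (1 / δ) with hν₁
  refine ⟨A / 2, max 1 (max (4 * A₂ / A) ν₁), by positivity, fun ν hν => ?_⟩
  have hν1 : 1 ≤ |ν| := (le_max_left _ _).trans hν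
  have hνpos : 0 < |ν| := lt_of_lt_of_le one_pos hν1
  have hν0 : ν ≠ 0 := abs_pos.1 hνpos
  have hmain := hK ν hν0
  set E : ℝ := |ν| ^ (-β.re - 1) with hE
  have hE0 : 0 < E := Real.rpow_pos_of_pos hνpos _
  -- (1) the leading term is at least `A E`
  have h1 : A * E ≤ ‖h 0 * ((1 / (1 - I * ν)) ^ (β + 1) * Complex.Gamma (β + 1))‖ := by
    rw [norm_mul, norm_mul, hA, hE]
    have := le_norm_one_div_one_sub_I_mul_cpow hν1 (w := β + 1) (by simp; linarith)
    simp only [Complex.add_re, Complex.one_re] at this ⊢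
    rw [show -β.re - 1 = -(β.re + 1) by ring]
    calc ‖h 0‖ * (Real.exp (-(Real.pi / 2 * |(β + 1).im|)) * Real.sqrt 2 ^ (-(β.re + 1)) *
        ‖Complex.Gamma (β + 1)‖) * |ν| ^ (-(β.re + 1)) =
        ‖h 0‖ * ((Real.exp (-(Real.pi / 2 * |(β + 1).im|)) * (Real.sqrt 2 ^ (-(β.re + 1)) *
          |ν| ^ (-(β.re + 1)))) * ‖Complex.Gamma (β + 1)‖) := by ring
      _ ≤ ‖h 0‖ * (‖(1 / (1 - I * ↑ν)) ^ (β + 1)‖ * ‖Complex.Gamma (β + 1)‖) := by gcongr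
  -- (2) the second term is at most `A₂ E / |ν| ≤ (A/4) E`
  have h2 : ‖(deriv h 0 + h 0) * ((1 / (1 - I * ν)) ^ (β + 2) * Complex.Gamma (β + 2))‖ ≤
      A / 4 * E := by
    rw [norm_mul, norm_mul]
    have := norm_one_div_one_sub_I_mul_cpow_le hν0 (w := β + 2) (by simp; linarith)
    simp only [Complex.add_re] at this
    have hpow : |ν| ^ (-(β.re + (2 : ℂ).re)) = E * |ν|⁻¹ := by
      rw [hE, show (-(β.re + (2 : ℂ).re)) = (-β.re - 1) + (-1) by simp; ring,
        Real.rpow_add hνpos, Real.rpow_neg_one]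
    have hνA : 4 * A₂ / A ≤ |ν| := (le_max_left _ _).trans ((le_max_right _ _).trans hν)
    have hinv : A₂ * |ν|⁻¹ ≤ A / 4 := by
      rw [← div_eq_mul_inv, div_le_iff₀ hνpos]
      have := (div_le_iff₀ hA0).1 hνA
      linarith
    calc ‖deriv h 0 + h 0‖ * (‖(1 / (1 - I * ↑ν)) ^ (β + 2)‖ * ‖Complex.Gamma (β + 2)‖) ≤
        ‖deriv h 0 + h 0‖ * (Real.exp (Real.pi / 2 * |(β + 2).im|) * |ν| ^ (-(β.re + (2 : ℂ).re)) *
          ‖Complex.Gamma (β + 2)‖) := by gcongr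
      _ = A₂ * |ν|⁻¹ * E := by rw [hpow, hA₂]; ring
      _ ≤ A / 4 * E := mul_le_mul_of_nonneg_right hinv hE0.le
  -- (3) the remainder is at most `(A/4) E`
  have h3 : CK * |ν| ^ (-(m : ℝ)) ≤ A / 4 * E := by
    have hpow : |ν| ^ (-(m : ℝ)) = E * (|ν| ^ δ)⁻¹ := by
      rw [hE, hδ, ← Real.rpow_neg hνpos.le, ← Real.rpow_add hνpos]; congr 1; ring
    have hνδ : 4 * |CK| / A + 1 ≤ |ν| ^ δ := by
      have hb : 0 ≤ 4 * |CK| / A + 1 := by positivity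
      have hν₁le : ν₁ ≤ |ν| := (le_max_right _ _).trans ((le_max_right _ _).trans hν)
      have hν₁0 : 0 ≤ ν₁ := Real.rpow_nonneg hb _
      calc 4 * |CK| / A + 1 = ν₁ ^ δ := by
            rw [hν₁, ← Real.rpow_mul hb, one_div, inv_mul_cancel₀ hδ0.ne', Real.rpow_one]
        _ ≤ |ν| ^ δ := Real.rpow_le_rpow hν₁0 hν₁le hδ0.le
    have hνδpos : 0 < |ν| ^ δ := Real.rpow_pos_of_pos hνpos _
    have hinv : |CK| * (|ν| ^ δ)⁻¹ ≤ A / 4 := by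
      rw [← div_eq_mul_inv, div_le_iff₀ hνδpos]
      have h4 : 4 * |CK| / A ≤ |ν| ^ δ - 1 := by linarith
      have := (div_le_iff₀ hA0).1 h4
      nlinarith
    calc CK * |ν| ^ (-(m : ℝ)) ≤ |CK| * |ν| ^ (-(m : ℝ)) :=
          mul_le_mul_of_nonneg_right (le_abs_self _) (Real.rpow_nonneg hνpos.le _)
      _ = |CK| * (|ν| ^ δ)⁻¹ * E := by rw [hpow]; ring
      _ ≤ A / 4 * E := mul_le_mul_of_nonneg_right hinv hE0.le
  -- assemble: `‖I‖ ≥ ‖M₁‖ − ‖M₂‖ − ‖I − (M₁+M₂)‖`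
  have htri : ‖h 0 * ((1 / (1 - I * ν)) ^ (β + 1) * Complex.Gamma (β + 1))‖ -
      ‖(deriv h 0 + h 0) * ((1 / (1 - I * ν)) ^ (β + 2) * Complex.Gamma (β + 2))‖ -
      ‖(∫ t in Ioi (0 : ℝ), Complex.exp (I * ν * t) * (t : ℂ) ^ β * h t) -
          (h 0 * ((1 / (1 - I * ν)) ^ (β + 1) * Complex.Gamma (β + 1)) +
            (deriv h 0 + h 0) * ((1 / (1 - I * ν)) ^ (β + 2) * Complex.Gamma (β + 2)))‖ ≤
      ‖∫ t in Ioi (0 : ℝ), Complex.exp (I * ν * t) * (t : ℂ) ^ β * h t‖ := by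
    set M₁ := h 0 * ((1 / (1 - I * ν)) ^ (β + 1) * Complex.Gamma (β + 1))
    set M₂ := (deriv h 0 + h 0) * ((1 / (1 - I * ν)) ^ (β + 2) * Complex.Gamma (β + 2))
    set Iν := ∫ t in Ioi (0 : ℝ), Complex.exp (I * ν * t) * (t : ℂ) ^ β * h t
    have e1 : ‖M₁‖ ≤ ‖M₁ + M₂‖ + ‖M₂‖ := by
      have := norm_le_insert' M₁ (M₁ + M₂)
      rwa [show M₁ - (M₁ + M₂) = -M₂ by ring, norm_neg] at this
    have e2 : ‖M₁ + M₂‖ ≤ ‖Iν‖ + ‖Iν - (M₁ + M₂)‖ := by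
      have := norm_le_insert' (M₁ + M₂) Iν
      rwa [← norm_neg (M₁ + M₂ - Iν), neg_sub] at this
    linarith
  linarith [h1, h2, h3, htri, hmain]

end Costa2019

end Literature.Geometry.Lorentzian.Kerr

end
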